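import Summits.Langlands.Langlands.Statement
import Literature.NumberTheory.GaloisRepresentations.HeckeCharacter
import Literature.NumberTheory.Automorphic.AutomorphicInductionCharacter
import HarnessLib

/-!
# Stub `stub_cmSatakeFrobGlue` of the line `top-degree-exact-control` (crux
# `SkinnerWilesDefectOne.ProModularOrdinaryClassical`, stmt-Langlands-12921): the Satake–Frobenius glue of
# the CM regime

Registered stub of the checked skeleton `Cruxes/ProModularOrdinaryClassical/Lines/top-degree-exact-control.lean`
(rev 6), CM regime, glue.  Pure bookkeeping between the automorphic and the Galois normalisations: if `π` on
`GL₂(𝔸_F)` has at almost every finite place `v` a Satake parameter `α` with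
`∏_{a ∈ α} (X - a) = ∏_{w ∣ v} (X^{f(w|v)} - θ(ϖ_w))` (`θ` a Hecke character of an extension `K/F`), and
`ρ : Γ_F → GL₂(ℚ̄_p)` is at almost every `v` unramified with arithmetic-Frobenius characteristic polynomial
`∏_{w ∣ v} (X^{f(w|v)} - ι⁻¹(θ(ϖ_w)⁻¹))`, then `Summit.Langlands.SatakeFrobCompatibleAt ι π ρ v` for almost all
`v`, i.e. (Buzzard–Gee's unramified dictionary, `arithFrobPolyOfSatake ι q_v 1 α = ∏_{a ∈ α} (X - ι⁻¹(a⁻¹))`)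
the polynomial identity

  `∏_{a ∈ α} (X - ι⁻¹(a⁻¹)) = ∏_{w ∣ v} (X^{f(w|v)} - ι⁻¹(θ(ϖ_w)⁻¹))`.

Proof (no automorphic or Galois input): `ℂ` is algebraically closed, so `α` — the roots of the left-hand side —
is the sum over `w ∣ v` of the multisets of `f(w|v)`-th roots of `θ(ϖ_w)` (`Polynomial.roots_prod`,
`Polynomial.nthRoots`); for `c ≠ 0` and `0 < f` inversion is a bijection from the `f`-th roots of `c` onto the
`f`-th roots of `c⁻¹` (both sets have `f` elements: `X^f - c` is separable in characteristic `0`), whence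
`∏_{a : a^f = c} (X - a⁻¹) = X^f - c⁻¹` (`Polynomial.Splits.eq_prod_roots_of_monic`); here `θ(ϖ_w) ∈ ℂˣ` is
non-zero and `f(w|v) = [k(w) : k(v)] ≥ 1` (Mathlib `Ideal.inertiaDeg_pos`); finally everything is pushed
through the ring isomorphism `ι⁻¹ : ℂ ≃+* ℚ̄_p` (`Polynomial.map`), the finite products over
`{w | w ∩ 𝓞_F = v}` being genuine `Finset` products (`finite_setOf_under_eq'`).

Declared in the skeleton's namespace `Summit.Langlands.Langlands.Cruxes.ProModularOrdinaryClassical.TopDegreeExactControl`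
so that the landed theorem reads byte-identically to its registration.  What is NOT here: any statement about
the existence of `π` (the sibling stub `stub_cmInducedCuspidal`) or of `ρ`.
References: [BuzzardGeeLMS2014] Conj. 3.2.1 and Rem. 3.2.5 (the dictionary); [ArthurClozelAMS120] Ch. 3
Def. 6.1, (6.1)–(6.2) (the shape of the induced local factor).
-/

noncomputable section

namespace Summit.Langlands.Langlands.Cruxes.ProModularOrdinaryClassical.TopDegreeExactControl

set_option linter.dupNamespace false

open Literature.NumberTheory.Automorphic Literature.NumberTheory.GaloisRepresentations
open NumberField IsDedekindDomain Filter Polynomial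
open scoped BigOperators Classical

/-! ## Polynomial algebra over `ℂ`: inverting the roots of `X ^ f - c` -/

/-- For `c ≠ 0` and `0 < f`, inversion maps the multiset of `f`-th roots of `c` in `ℂ` onto the multiset of
`f`-th roots of `c⁻¹`: `a ↦ a⁻¹` is injective and sends roots to roots, the source has `f` distinct elements
(`X ^ f - c` splits over `ℂ` and is separable in characteristic `0`) and the target has at most `f`. [folklore] -/
theorem nthRoots_map_inv {f : ℕ} (hf : 0 < f) {c : ℂ} (hc : c ≠ 0) :
    (nthRoots f c).map Inv.inv = nthRoots f c⁻¹ := by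
  have hsplit : (X ^ f - C c : ℂ[X]).Splits := IsAlgClosed.splits _
  have hcard : Multiset.card (nthRoots f c) = f := by
    rw [nthRoots, ← hsplit.natDegree_eq_card_roots, natDegree_X_pow_sub_C]
  have hnodup : (nthRoots f c).Nodup :=
    nodup_roots (separable_X_pow_sub_C c (Nat.cast_ne_zero.mpr hf.ne') hc)
  refine Multiset.eq_of_le_of_card_le ?_ ?_
  · rw [Multiset.le_iff_subset (hnodup.map inv_injective)]
    intro x hx
    obtain ⟨a, ha, rfl⟩ := Multiset.mem_map.mp hx
    rw [mem_nthRoots hf] at ha ⊢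
    rw [inv_pow, ha]
  · rw [Multiset.card_map, hcard]
    exact card_nthRoots f c⁻¹

/-- For `c ≠ 0` and `0 < f`: `∏_{a : a^f = c} (X - a⁻¹) = X ^ f - c⁻¹` in `ℂ[X]` (roots counted with
multiplicity, i.e. over `Polynomial.nthRoots f c`), because the right-hand side is monic, splits over `ℂ`, and
its roots are the inverses of the `f`-th roots of `c` (`nthRoots_map_inv`). [folklore] -/
theorem prod_nthRoots_X_sub_C_inv {f : ℕ} (hf : 0 < f) {c : ℂ} (hc : c ≠ 0) :
    ((nthRoots f c).map fun a => X - C a⁻¹).prod = X ^ f - C c⁻¹ := by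
  have h := (IsAlgClosed.splits (X ^ f - C c⁻¹ : ℂ[X])).eq_prod_roots_of_monic
    (monic_X_pow_sub_C _ hf.ne')
  have hroots : (X ^ f - C c⁻¹ : ℂ[X]).roots = (nthRoots f c).map Inv.inv :=
    (nthRoots_map_inv hf hc).symm
  rw [hroots, Multiset.map_map] at h
  exact h.symm

/-- **The glue identity over `ℂ`.** If `∏_{a ∈ α} (X - a) = ∏_{w ∈ s} (X ^ {f w} - c_w)` with all `f w ≥ 1`
and all `c_w ≠ 0`, then `∏_{a ∈ α} (X - a⁻¹) = ∏_{w ∈ s} (X ^ {f w} - c_w⁻¹)`: `α` is the multiset of roots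
of the right-hand side, the sum over `w ∈ s` of the `f w`-th roots of `c_w` (`Polynomial.roots_prod`), and
each block is handled by `prod_nthRoots_X_sub_C_inv`.  (False without `f w ≥ 1`: `s = {1, 2}`, `f = 0`,
`c = 2`, `α = 0`.) [folklore] -/
theorem multisetProd_X_sub_C_inv_eq_finsetProd {σ : Type*} (s : Finset σ) (f : σ → ℕ) (c : σ → ℂ)
    (hf : ∀ w ∈ s, 0 < f w) (hc : ∀ w ∈ s, c w ≠ 0) (α : Multiset ℂ)
    (h : (α.map fun a => X - C a).prod = ∏ w ∈ s, (X ^ f w - C (c w))) :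
    (α.map fun a => X - C a⁻¹).prod = ∏ w ∈ s, (X ^ f w - C (c w)⁻¹) := by
  have hne : ∏ w ∈ s, (X ^ f w - C (c w) : ℂ[X]) ≠ 0 :=
    (monic_prod_of_monic _ _ fun w hw => monic_X_pow_sub_C (c w) (hf w hw).ne').ne_zero
  have hα : α = s.val.bind fun w => nthRoots (f w) (c w) := by
    have hr := congrArg Polynomial.roots h
    rw [roots_multiset_prod_X_sub_C, roots_prod _ _ hne] at hr
    exact hr
  subst hα
  rw [Multiset.map_bind, Multiset.prod_bind, Finset.prod_eq_multiset_prod]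
  congr 1
  refine Multiset.map_congr rfl fun w hw => ?_
  exact prod_nthRoots_X_sub_C_inv (hf w (Finset.mem_val.mp hw)) (hc w (Finset.mem_val.mp hw))

/-- **The glue identity pushed through a ring homomorphism `φ : ℂ →+* L`** (here `φ = ι⁻¹ : ℂ ≃+* ℚ̄_p`):
under the hypotheses of `multisetProd_X_sub_C_inv_eq_finsetProd`,
`∏_{a ∈ α} (X - φ(a⁻¹)) = ∏_{w ∈ s} (X ^ {f w} - φ(c_w⁻¹))` in `L[X]` (`Polynomial.map` is multiplicative).
[folklore] -/
theorem multisetProd_X_sub_C_map_inv_eq_finsetProd {L : Type*} [CommRing L] (φ : ℂ →+* L) {σ : Type*}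
    (s : Finset σ) (f : σ → ℕ) (c : σ → ℂ) (hf : ∀ w ∈ s, 0 < f w) (hc : ∀ w ∈ s, c w ≠ 0)
    (α : Multiset ℂ) (h : (α.map fun a => X - C a).prod = ∏ w ∈ s, (X ^ f w - C (c w))) :
    (α.map fun a => X - C (φ a⁻¹)).prod = ∏ w ∈ s, (X ^ f w - C (φ (c w)⁻¹)) := by
  have h4 := congrArg (Polynomial.map φ) (multisetProd_X_sub_C_inv_eq_finsetProd s f c hf hc α h)
  rw [Polynomial.map_multiset_prod, Multiset.map_map, Polynomial.map_prod] at h4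
  simpa only [Function.comp_def, Polynomial.map_sub, Polynomial.map_pow, Polynomial.map_X,
    Polynomial.map_C] using h4

/-! ## The registered stub -/

/-- **Stub `stub_cmSatakeFrobGlue` (CM regime, glue; registered signature, verbatim; line
`top-degree-exact-control`, skeleton rev 6).** Pure bookkeeping between the automorphic and the Galois
normalisations: if `π` on `GL₂(𝔸_F)` has at almost every `v` a Satake parameter `α` with
`∏_{a ∈ α} (X − a) = ∏_{w ∣ v} (X^{f(w|v)} − θ(ϖ_w))`, and `ρ : Γ_F → GL₂(ℚ̄_p)` is at almost every `v` unramified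
with arithmetic-Frobenius characteristic polynomial `∏_{w ∣ v} (X^{f(w|v)} − ι⁻¹(θ(ϖ_w))⁻¹)`, then
`SatakeFrobCompatibleAt ι π ρ v` for almost all `v`: on the intersection of the two cofinite sets, the summit's
polynomial `arithFrobPolyOfSatake ι q_v 1 α = ∏_{a ∈ α} (X − ι⁻¹(a⁻¹))` (`arithFrobPolyOfSatake_one`) equals
`∏_{w ∣ v} (X^{f(w|v)} − ι⁻¹(θ(ϖ_w))⁻¹)` by `multisetProd_X_sub_C_map_inv_eq_finsetProd` over the finite set of
places of `K` above `v` (`finite_setOf_under_eq'`), with `θ(ϖ_w) ≠ 0` (a value in `ℂˣ`) and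
`f(w|v) ≥ 1` (`Ideal.inertiaDeg_pos`).  The hypothesis `[K : F] = 2` is not used.  No automorphic or Galois
input. [cite: BuzzardGeeLMS2014, Conj. 3.2.1 and Rem. 3.2.5] -/
theorem stub_cmSatakeFrobGlue : ∀ (F : Type) [Field F] [NumberField F] (p : ℕ) [Fact p.Prime] (hcpt : Literature.NumberTheory.Automorphic.isCompact_glFiniteIntegralLevel 2 F) (ι : PadicAlgCl p ≃+* ℂ) (ρ : Literature.NumberTheory.GaloisRepresentations.FramedGaloisRep F (PadicAlgCl p) 2) (K : Type) [Field K] [NumberField K] [Algebra F K], Module.finrank F K = 2 → ∀ (θ : Literature.NumberTheory.GaloisRepresentations.HeckeCharacter K) (π : Literature.NumberTheory.Automorphic.CuspidalAutomorphicRepData 2 F hcpt), (∀ᶠ v : IsDedekindDomain.HeightOneSpectrum (NumberField.RingOfIntegers F) in Filter.cofinite, ∃ α : Multiset ℂ, π.1.HasSatakeParamAt v α ∧ Literature.NumberTheory.Automorphic.satakePolynomial α = ∏ᶠ w ∈ {w : IsDedekindDomain.HeightOneSpectrum (NumberField.RingOfIntegers K) | w.under (NumberField.RingOfIntegers F) =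 v}, (Polynomial.X ^ w.asIdeal.inertiaDeg (NumberField.RingOfIntegers F) - Polynomial.C (θ.valueAtUniformizer w))) → (∀ᶠ v : IsDedekindDomain.HeightOneSpectrum (NumberField.RingOfIntegers F) in Filter.cofinite, ρ.IsUnramifiedAt v ∧ ρ.HasFrobCharpolyAt v (∏ᶠ w ∈ {w : IsDedekindDomain.HeightOneSpectrum (NumberField.RingOfIntegers K) | w.under (NumberField.RingOfIntegers F) = v}, (Polynomial.X ^ w.asIdeal.inertiaDeg (NumberField.RingOfIntegers F) - Polynomial.C (ι.symm (θ.valueAtUniformizer w)⁻¹)))) → ∀ᶠ v : IsDedekindDomain.HeightOneSpectrum (NumberField.RingOfIntegers F) in Filter.cofinite, Summit.Langlands.SatakeFrobCompatibleAt ι π.1 ρ v := by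
  intro F _ _ p _ hcpt ι ρ K _ _ _ _ θ π hsat hfrob
  refine (hsat.and hfrob).mono fun v hv => ?_
  obtain ⟨⟨α, hα, hpoly⟩, hunr, hchar⟩ := hv
  refine ⟨α, hα, hunr, ?_⟩
  have hS := finite_setOf_under_eq' (F := F) (E := K) v
  have key : arithFrobPolyOfSatake ι v.residueCard 1 α =
      ∏ᶠ w ∈ {w : HeightOneSpectrum (𝓞 K) | w.under (𝓞 F) = v},
        (X ^ w.asIdeal.inertiaDeg (𝓞 F) - C (ι.symm (θ.valueAtUniformizer w)⁻¹)) := by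
    rw [arithFrobPolyOfSatake_one, finprod_mem_eq_finite_toFinset_prod _ hS]
    rw [satakePolynomial, finprod_mem_eq_finite_toFinset_prod _ hS] at hpoly
    have h3 := multisetProd_X_sub_C_map_inv_eq_finsetProd (ι.symm : ℂ →+* PadicAlgCl p) hS.toFinset
      (fun w => w.asIdeal.inertiaDeg (𝓞 F)) (fun w => θ.valueAtUniformizer w)
      (fun w _ => Ideal.inertiaDeg_pos w.asIdeal (𝓞 F)) (fun w _ => Units.ne_zero _) α hpoly
    simpa only [RingHom.coe_coe] using h3
  rw [key]
  exact hchar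

end Summit.Langlands.Langlands.Cruxes.ProModularOrdinaryClassical.TopDegreeExactControl

end
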